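import Mathlib
import Literature.Analysis.FluidPDE.StretchedLayerNS
import Literature.NumberTheory.LFunctions.WeilWindowSuzukiAsymptoticProofs
import HarnessLib

/-!
# Stub `stub_saddleExit` of the line `braid-closed-large-circulation-gluing`
# (crux stmt-AnomalousDissipation-3009, `MarginalStabilityChain.StretchedVortexRows`)

An explicit exit-time supersolution of the frozen row operator
`𝒜ψ = νΔψ + u₀ ∂ₓψ + (v₀ − y) ∂_yψ`, `u₀ = sinh b/(2(cosh b − cos a))`,
`v₀ = −sin a/(2(cosh b − cos a))`, `a = 2πx/L`, `b = 2πy/L`, on a small closed disc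
`D = {(x − L/2)² + y² ≤ ρ²}` about the SADDLE stagnation point `(L/2, 0)` of the row field, in the
tree's slice-derivative vocabulary `StretchedLayer.dX/dY/lap`
(`Literature.Analysis.FluidPDE.StretchedLayerNS`).

## Construction (all constants explicit)

Put `X = x − L/2`, `Y = y`, `s = π/(2L)`, so that `a = 4sX + π`, `b = 4sY`, hence
`cos a = −cos(4sX)`, `sin a = −sin(4sX)` and the drift is
`u₀ = sinh(4sY)/(2E)`, `v₀ − y = sin(4sX)/(2E) − Y` with `E = cosh(4sY) + cos(4sX) ≥ 1` on
`|4sX| ≤ 1`. Its linearisation at the saddle is `M(X, Y) = (sY, sX − Y)`, `M = [[0, s], [s, −1]]`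
symmetric indefinite. Instead of diagonalising `M` we use the quadratic form of `s²M⁻¹`,
`Q(X, Y) = X² + 2sXY` (Hessian `2S`, `S = [[1, s], [s, 0]]`, and `MS = s²·Id`), for which the
linearised transport is ISOTROPIC: `M(X,Y)·∇Q = 2s²(X² + Y²)`. The supersolution is the polynomial

  `ψ(x, y) = ((1 + s)ρ² − X² − 2sXY)/ν`,

with `νΔψ = −2`, `∂ₓψ = (−2X − 2sY)/ν`, `∂_yψ = −2sX/ν`, so that
`𝒜ψ = −2 − (2/ν)·P`, `P = u₀(X + sY) + (v₀ − y)·sX = s²(X² + Y²) + e₁(X + sY) + e₂·sX`, where the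
Taylor remainders `e₁ = u₀ − sY`, `e₂ = v₀ − sX` obey `|eᵢ| ≤ (4sX)² + (4sY)² = 16s²(X² + Y²)` as
soon as `|4sX|, |4sY| ≤ 1` (crude second-order bounds from `|exp t − 1 − t| ≤ t²`,
`1 − t²/2 ≤ cos t`, `|t − sin t| ≤ |t|³/6`). On the disc `|X|, |Y| ≤ ρ`, so
`P ≥ s²(X² + Y²)(1 − 16ρ(1 + 2s)) ≥ 0` once `ρ ≤ ρ₁ := 1/(16(1 + 2s))` (which also gives
`4sρ ≤ 1/8`), whence `𝒜ψ ≤ −2 ≤ −1`. Finally `0 ≤ ψ ≤ (1 + 2s)ρ²/ν` on the disc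
(`2|XY| ≤ X² + Y² ≤ ρ²`), so `C := (1 + 2s)ρ²` (chosen after `ρ`, independent of `ν`).

## Contents

* the slice derivatives / Laplacian / smoothness of the quadratic `ψ` (taken through an equation
  hypothesis `hψ : ψ = fun x y => …`, no new definition): `hasDerivAt_saddlePsi_fst/snd`,
  `dX_saddlePsi`, `dY_saddlePsi`, `lap_saddlePsi`, `contDiff_saddlePsi`, and the two size bounds
  `saddlePsi_nonneg`, `saddlePsi_le`;
* elementary second-order bounds `abs_cosh_sub_one_le`, `abs_one_sub_cos_le`,
  `abs_sin_sub_self_le`, `one_le_cosh_add_cos` (and the tree's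
  `Literature.NumberTheory.LFunctions.abs_sinh_sub_le`);
* the remainder bounds `abs_rowU_sub_lin_le`, `abs_rowV_sub_lin_le`, the transport positivity
  `saddle_transport_nonneg` and the pointwise operator inequality `saddle_operator_le`;
* the registered statement `stub_saddleExit`.
-/

-- `Summit.<Summit>.<Problem>` is the mandated summit-side namespace (CONVENTIONS §2): duplicate deliberate.
set_option linter.dupNamespace false

noncomputable section

open scoped Topology
open Set

namespace Summit.AnomalousDissipation.AnomalousDissipation.Theorems.MarginalStabilityChainStretchedVortexRows

open Literature.Analysis.FluidPDE Literature.Analysis.FluidPDE.StretchedLayer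

namespace SaddleExit

/-! ### The quadratic supersolution and its derivatives

The supersolution is the polynomial field
`ψ = fun x y => ((1 + s)ρ² − (x − L/2)² − 2s(x − L/2)y)/ν`; to keep the file free of new
definitions every lemma below takes it through the equation hypothesis `hψ : ψ = …` (discharged by
`rfl` at the call site). Its Hessian form `S = [[1, s], [s, 0]]` satisfies `MS = s²·Id` for the
saddle linearisation `M = [[0, s], [s, −1]]` of the row drift (`s = π/(2L)` in the application). -/

/-- `∂ₓψ = (−2(x − L/2) − 2sy)/ν` (as a `HasDerivAt` of the `x`-slice). [folklore] -/
theorem hasDerivAt_saddlePsi_fst {L s ρ ν : ℝ} {ψ : ℝ → ℝ → ℝ}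
    (hψ : ψ = fun x y => ((1 + s) * ρ ^ 2 - (x - L / 2) ^ 2 - 2 * s * (x - L / 2) * y) / ν)
    (x y : ℝ) : HasDerivAt (fun x' => ψ x' y) ((-2 * (x - L / 2) - 2 * s * y) / ν) x := by
  subst hψ
  have h1 : HasDerivAt (fun x' : ℝ => x' - L / 2) 1 x := (hasDerivAt_id x).sub_const _
  have h2 := h1.fun_pow 2
  have h3 := (h1.const_mul (2 * s)).mul_const y
  have h4 := ((h2.const_sub ((1 + s) * ρ ^ 2)).fun_sub h3).div_const ν
  exact h4.congr_deriv (by simp only [Nat.cast_ofNat, Nat.reduceSub, pow_one]; ring)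

/-- `∂_yψ = −2s(x − L/2)/ν` (as a `HasDerivAt` of the `y`-slice). [folklore] -/
theorem hasDerivAt_saddlePsi_snd {L s ρ ν : ℝ} {ψ : ℝ → ℝ → ℝ}
    (hψ : ψ = fun x y => ((1 + s) * ρ ^ 2 - (x - L / 2) ^ 2 - 2 * s * (x - L / 2) * y) / ν)
    (x y : ℝ) : HasDerivAt (fun y' => ψ x y') (-(2 * s * (x - L / 2)) / ν) y := by
  subst hψ
  have h1 : HasDerivAt (fun y' : ℝ => 2 * s * (x - L / 2) * y') (2 * s * (x - L / 2) * 1) y :=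
    (hasDerivAt_id y).const_mul _
  have h4 := (h1.const_sub ((1 + s) * ρ ^ 2 - (x - L / 2) ^ 2)).div_const ν
  exact h4.congr_deriv (by ring)

/-- `dX ψ` in closed form (as a curried field). [folklore] -/
theorem dX_saddlePsi {L s ρ ν : ℝ} {ψ : ℝ → ℝ → ℝ}
    (hψ : ψ = fun x y => ((1 + s) * ρ ^ 2 - (x - L / 2) ^ 2 - 2 * s * (x - L / 2) * y) / ν) :
    dX ψ = fun x y => (-2 * (x - L / 2) - 2 * s * y) / ν := by
  funext x y
  exact (hasDerivAt_saddlePsi_fst hψ x y).deriv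

/-- `dY ψ` in closed form (as a curried field). [folklore] -/
theorem dY_saddlePsi {L s ρ ν : ℝ} {ψ : ℝ → ℝ → ℝ}
    (hψ : ψ = fun x y => ((1 + s) * ρ ^ 2 - (x - L / 2) ^ 2 - 2 * s * (x - L / 2) * y) / ν) :
    dY ψ = fun x _ => -(2 * s * (x - L / 2)) / ν := by
  funext x y
  exact (hasDerivAt_saddlePsi_snd hψ x y).deriv

/-- `Δψ = −2/ν`. [folklore] -/
theorem lap_saddlePsi {L s ρ ν : ℝ} {ψ : ℝ → ℝ → ℝ}
    (hψ : ψ = fun x y => ((1 + s) * ρ ^ 2 - (x - L / 2) ^ 2 - 2 * s * (x - L / 2) * y) / ν)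
    (x y : ℝ) : lap ψ x y = -2 / ν := by
  rw [lap_apply, dX_saddlePsi hψ, dY_saddlePsi hψ]
  simp only [dX, dY, deriv_const, add_zero]
  have h1 : HasDerivAt (fun x' : ℝ => x' - L / 2) 1 x := (hasDerivAt_id x).sub_const _
  have h2 := ((h1.const_mul (-2)).sub_const (2 * s * y)).div_const ν
  rw [h2.deriv]
  ring

/-- `ψ` is a polynomial, hence `Cⁿ` jointly. [folklore] -/
theorem contDiff_saddlePsi {L s ρ ν : ℝ} {ψ : ℝ → ℝ → ℝ}
    (hψ : ψ = fun x y => ((1 + s) * ρ ^ 2 - (x - L / 2) ^ 2 - 2 * s * (x - L / 2) * y) / ν)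
    {n : WithTop ℕ∞} : ContDiff ℝ n (fun q : ℝ × ℝ => ψ q.1 q.2) := by
  subst hψ
  fun_prop

/-- `ψ ≥ 0` on the saddle disc (`s ≥ 0`, `ν > 0`). [folklore] -/
theorem saddlePsi_nonneg {L s ρ ν : ℝ} {ψ : ℝ → ℝ → ℝ}
    (hψ : ψ = fun x y => ((1 + s) * ρ ^ 2 - (x - L / 2) ^ 2 - 2 * s * (x - L / 2) * y) / ν)
    (hs : 0 ≤ s) (hν : 0 < ν) {x y : ℝ} (hq : (x - L / 2) ^ 2 + y ^ 2 ≤ ρ ^ 2) : 0 ≤ ψ x y := by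
  subst hψ
  apply div_nonneg _ hν.le
  have h1 : 0 ≤ (1 + s) * (ρ ^ 2 - ((x - L / 2) ^ 2 + y ^ 2)) :=
    mul_nonneg (by positivity) (sub_nonneg.2 hq)
  nlinarith [mul_nonneg hs (sq_nonneg (x - L / 2 - y)), sq_nonneg y]

/-- `ψ ≤ (1 + 2s)ρ²/ν` on the saddle disc (`s ≥ 0`, `ν > 0`). [folklore] -/
theorem saddlePsi_le {L s ρ ν : ℝ} {ψ : ℝ → ℝ → ℝ}
    (hψ : ψ = fun x y => ((1 + s) * ρ ^ 2 - (x - L / 2) ^ 2 - 2 * s * (x - L / 2) * y) / ν)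
    (hs : 0 ≤ s) (hν : 0 < ν) {x y : ℝ} (hq : (x - L / 2) ^ 2 + y ^ 2 ≤ ρ ^ 2) :
    ψ x y ≤ (1 + 2 * s) * ρ ^ 2 / ν := by
  subst hψ
  apply div_le_div_of_nonneg_right _ hν.le
  have h1 : 0 ≤ s * (ρ ^ 2 - ((x - L / 2) ^ 2 + y ^ 2)) := mul_nonneg hs (sub_nonneg.2 hq)
  nlinarith [mul_nonneg hs (sq_nonneg (x - L / 2 + y)), sq_nonneg (x - L / 2)]

/-! ### Elementary second-order bounds

(`|sinh t − t| ≤ t²` on `|t| ≤ 1` is the tree's `Literature.NumberTheory.LFunctions.abs_sinh_sub_le`.) -/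

/-- `|cosh t − 1| ≤ t²` for `|t| ≤ 1` (from `|exp t − 1 − t| ≤ t²`). [folklore] -/
theorem abs_cosh_sub_one_le {t : ℝ} (ht : |t| ≤ 1) : |Real.cosh t - 1| ≤ t ^ 2 := by
  have h1 := Real.abs_exp_sub_one_sub_id_le ht
  have h2 := Real.abs_exp_sub_one_sub_id_le (x := -t) (by rwa [abs_neg])
  have hrw : Real.cosh t - 1
      = ((Real.exp t - 1 - t) + (Real.exp (-t) - 1 - (-t))) / 2 := by
    rw [Real.cosh_eq]; ring
  rw [hrw, abs_div, abs_two, div_le_iff₀ (by norm_num : (0 : ℝ) < 2)]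
  calc |(Real.exp t - 1 - t) + (Real.exp (-t) - 1 - (-t))|
      ≤ |Real.exp t - 1 - t| + |Real.exp (-t) - 1 - (-t)| := abs_add_le _ _
    _ ≤ t ^ 2 + (-t) ^ 2 := add_le_add h1 h2
    _ = t ^ 2 * 2 := by ring

/-- `|1 − cos t| ≤ t²` (every `t`; from `1 − t²/2 ≤ cos t ≤ 1`). [folklore] -/
theorem abs_one_sub_cos_le (t : ℝ) : |1 - Real.cos t| ≤ t ^ 2 := by
  rw [abs_of_nonneg (sub_nonneg.2 (Real.cos_le_one t))]
  nlinarith [Real.one_sub_sq_div_two_le_cos (x := t), sq_nonneg t]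

/-- `|sin t − t| ≤ t²` for `|t| ≤ 1` (from `|t − sin t| ≤ |t|³/6`). [folklore] -/
theorem abs_sin_sub_self_le {t : ℝ} (ht : |t| ≤ 1) : |Real.sin t - t| ≤ t ^ 2 := by
  rw [abs_sub_comm]
  have h3 : |t| ^ 3 = |t| * t ^ 2 := by rw [← sq_abs t]; ring
  have h4 : |t| * t ^ 2 ≤ 1 * t ^ 2 := mul_le_mul_of_nonneg_right ht (sq_nonneg t)
  calc |t - Real.sin t| ≤ |t| ^ 3 / 6 := Real.abs_sub_sin_le t
    _ ≤ t ^ 2 := by rw [h3]; nlinarith [sq_nonneg t]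

/-- On `|α| ≤ 1` the saddle-centred denominator `E = cosh β + cos α` is `≥ 1`. [folklore] -/
theorem one_le_cosh_add_cos {α : ℝ} (β : ℝ) (hα : |α| ≤ 1) : 1 ≤ Real.cosh β + Real.cos α := by
  have h1 := Real.one_le_cosh β
  have hα' := abs_le.mp hα
  have h2 : 0 ≤ Real.cos α :=
    Real.cos_nonneg_of_mem_Icc ⟨by linarith [Real.pi_gt_three], by linarith [Real.pi_gt_three]⟩
  linarith

/-! ### Second-order remainders of the row drift at the saddle -/

/-- `|sinh β/(2(cosh β + cos α)) − β/4| ≤ α² + β²` for `|α|, |β| ≤ 1`: the `x`-component `u₀` of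
the row drift minus its linearisation at the saddle. [folklore] -/
theorem abs_rowU_sub_lin_le {α β : ℝ} (hα : |α| ≤ 1) (hβ : |β| ≤ 1) :
    |Real.sinh β / (2 * (Real.cosh β + Real.cos α)) - β / 4| ≤ α ^ 2 + β ^ 2 := by
  have hE1 : 1 ≤ Real.cosh β + Real.cos α := one_le_cosh_add_cos β hα
  have hE4 : 0 < 4 * (Real.cosh β + Real.cos α) := by linarith
  have hE0 : Real.cosh β + Real.cos α ≠ 0 := by linarith
  have hrw : Real.sinh β / (2 * (Real.cosh β + Real.cos α)) - β / 4
      = (2 * (Real.sinh β - β) - β * (Real.cosh β - 1) + β * (1 - Real.cos α))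
          / (4 * (Real.cosh β + Real.cos α)) := by
    field_simp
    ring
  rw [hrw, abs_div, abs_of_pos hE4, div_le_iff₀ hE4]
  have e1 := Literature.NumberTheory.LFunctions.abs_sinh_sub_le hβ
  have e2 := mul_le_mul hβ (abs_cosh_sub_one_le hβ) (abs_nonneg _) zero_le_one
  have e3 := mul_le_mul hβ (abs_one_sub_cos_le α) (abs_nonneg _) zero_le_one
  have hsum : 0 ≤ (α ^ 2 + β ^ 2) * (Real.cosh β + Real.cos α - 1) :=
    mul_nonneg (by positivity) (sub_nonneg.2 hE1)
  calc |2 * (Real.sinh β - β) - β * (Real.cosh β - 1) + β * (1 - Real.cos α)|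
      ≤ |2 * (Real.sinh β - β) - β * (Real.cosh β - 1)| + |β * (1 - Real.cos α)| := abs_add_le _ _
    _ ≤ |2 * (Real.sinh β - β)| + |β * (Real.cosh β - 1)| + |β * (1 - Real.cos α)| := by
        gcongr; exact abs_sub _ _
    _ = 2 * |Real.sinh β - β| + |β| * |Real.cosh β - 1| + |β| * |1 - Real.cos α| := by
        rw [abs_mul, abs_mul, abs_mul, abs_two]
    _ ≤ 2 * β ^ 2 + 1 * β ^ 2 + 1 * α ^ 2 := by linarith
    _ ≤ (α ^ 2 + β ^ 2) * (4 * (Real.cosh β + Real.cos α)) := by nlinarith [sq_nonneg α]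

/-- `|sin α/(2(cosh β + cos α)) − α/4| ≤ α² + β²` for `|α|, |β| ≤ 1`: the `y`-component `v₀` of
the row drift minus its linearisation at the saddle. [folklore] -/
theorem abs_rowV_sub_lin_le {α β : ℝ} (hα : |α| ≤ 1) (hβ : |β| ≤ 1) :
    |Real.sin α / (2 * (Real.cosh β + Real.cos α)) - α / 4| ≤ α ^ 2 + β ^ 2 := by
  have hE1 : 1 ≤ Real.cosh β + Real.cos α := one_le_cosh_add_cos β hα
  have hE4 : 0 < 4 * (Real.cosh β + Real.cos α) := by linarith
  have hE0 : Real.cosh β + Real.cos α ≠ 0 := by linarith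
  have hrw : Real.sin α / (2 * (Real.cosh β + Real.cos α)) - α / 4
      = (2 * (Real.sin α - α) - α * (Real.cosh β - 1) + α * (1 - Real.cos α))
          / (4 * (Real.cosh β + Real.cos α)) := by
    field_simp
    ring
  rw [hrw, abs_div, abs_of_pos hE4, div_le_iff₀ hE4]
  have e1 := abs_sin_sub_self_le hα
  have e2 := mul_le_mul hα (abs_cosh_sub_one_le hβ) (abs_nonneg _) zero_le_one
  have e3 := mul_le_mul hα (abs_one_sub_cos_le α) (abs_nonneg _) zero_le_one
  have hsum : 0 ≤ (α ^ 2 + β ^ 2) * (Real.cosh β + Real.cos α - 1) :=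
    mul_nonneg (by positivity) (sub_nonneg.2 hE1)
  calc |2 * (Real.sin α - α) - α * (Real.cosh β - 1) + α * (1 - Real.cos α)|
      ≤ |2 * (Real.sin α - α) - α * (Real.cosh β - 1)| + |α * (1 - Real.cos α)| := abs_add_le _ _
    _ ≤ |2 * (Real.sin α - α)| + |α * (Real.cosh β - 1)| + |α * (1 - Real.cos α)| := by
        gcongr; exact abs_sub _ _
    _ = 2 * |Real.sin α - α| + |α| * |Real.cosh β - 1| + |α| * |1 - Real.cos α| := by
        rw [abs_mul, abs_mul, abs_mul, abs_two]
    _ ≤ 2 * α ^ 2 + 1 * β ^ 2 + 1 * α ^ 2 := by linarith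
    _ ≤ (α ^ 2 + β ^ 2) * (4 * (Real.cosh β + Real.cos α)) := by nlinarith [sq_nonneg β]

/-! ### The transport form and the operator inequality -/

/-- Positivity of the transport form on the saddle disc: with `E = cosh(4sY) + cos(4sX)`,
`P = (sinh(4sY)/(2E))(X + sY) + (sin(4sX)/(2E) − Y)(sX) ≥ 0` whenever `X² + Y² ≤ ρ²`,
`0 < ρ ≤ 1/(16(1 + 2s))`, `s > 0` (linear part `s²(X² + Y²)` absorbs the remainders). [folklore] -/
theorem saddle_transport_nonneg {s ρ X Y : ℝ} (hs : 0 < s) (hρ : 0 < ρ)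
    (hρ1 : ρ ≤ 1 / (16 * (1 + 2 * s))) (hq : X ^ 2 + Y ^ 2 ≤ ρ ^ 2) :
    0 ≤ Real.sinh (4 * s * Y) / (2 * (Real.cosh (4 * s * Y) + Real.cos (4 * s * X))) * (X + s * Y)
      + (Real.sin (4 * s * X) / (2 * (Real.cosh (4 * s * Y) + Real.cos (4 * s * X))) - Y)
        * (s * X) := by
  have h16 : ρ * (16 * (1 + 2 * s)) ≤ 1 := by rwa [le_div_iff₀ (by positivity)] at hρ1
  have hsρ : 4 * s * ρ ≤ 1 := by nlinarith
  have hX : |X| ≤ ρ := abs_le_of_sq_le_sq (by nlinarith [sq_nonneg Y]) hρ.le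
  have hY : |Y| ≤ ρ := abs_le_of_sq_le_sq (by nlinarith [sq_nonneg X]) hρ.le
  have h4s : 0 < 4 * s := by positivity
  have hα : |4 * s * X| ≤ 1 := by
    rw [abs_mul, abs_of_pos h4s]
    calc 4 * s * |X| ≤ 4 * s * ρ := by gcongr
      _ ≤ 1 := hsρ
  have hβ : |4 * s * Y| ≤ 1 := by
    rw [abs_mul, abs_of_pos h4s]
    calc 4 * s * |Y| ≤ 4 * s * ρ := by gcongr
      _ ≤ 1 := hsρ
  have e1 := abs_rowU_sub_lin_le hα hβ
  have e2 := abs_rowV_sub_lin_le hα hβ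
  generalize Real.sinh (4 * s * Y) / (2 * (Real.cosh (4 * s * Y) + Real.cos (4 * s * X))) = c₁
    at e1 ⊢
  generalize Real.sin (4 * s * X) / (2 * (Real.cosh (4 * s * Y) + Real.cos (4 * s * X))) = c₂
    at e2 ⊢
  have hE : (4 * s * X) ^ 2 + (4 * s * Y) ^ 2 = 16 * s ^ 2 * (X ^ 2 + Y ^ 2) := by ring
  have e1' : |c₁ - s * Y| ≤ 16 * s ^ 2 * (X ^ 2 + Y ^ 2) := by
    rw [← hE]; convert e1 using 2; ring
  have e2' : |c₂ - s * X| ≤ 16 * s ^ 2 * (X ^ 2 + Y ^ 2) := by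
    rw [← hE]; convert e2 using 2; ring
  have hXY : |X + s * Y| ≤ ρ + s * ρ := by
    calc |X + s * Y| ≤ |X| + |s * Y| := abs_add_le _ _
      _ = |X| + s * |Y| := by rw [abs_mul, abs_of_pos hs]
      _ ≤ ρ + s * ρ := by gcongr
  have hsX : |s * X| ≤ s * ρ := by
    rw [abs_mul, abs_of_pos hs]; gcongr
  have k1 : |(c₁ - s * Y) * (X + s * Y)| ≤ 16 * s ^ 2 * (X ^ 2 + Y ^ 2) * (ρ + s * ρ) := by
    rw [abs_mul]; exact mul_le_mul e1' hXY (abs_nonneg _) (by positivity)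
  have k2 : |(c₂ - s * X) * (s * X)| ≤ 16 * s ^ 2 * (X ^ 2 + Y ^ 2) * (s * ρ) := by
    rw [abs_mul]; exact mul_le_mul e2' hsX (abs_nonneg _) (by positivity)
  have k1' := neg_abs_le ((c₁ - s * Y) * (X + s * Y))
  have k2' := neg_abs_le ((c₂ - s * X) * (s * X))
  have key : c₁ * (X + s * Y) + (c₂ - Y) * (s * X)
      = s ^ 2 * (X ^ 2 + Y ^ 2) + (c₁ - s * Y) * (X + s * Y) + (c₂ - s * X) * (s * X) := by ring
  rw [key]
  have hpos : 0 ≤ s ^ 2 * (X ^ 2 + Y ^ 2) * (1 - ρ * (16 * (1 + 2 * s))) :=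
    mul_nonneg (by positivity) (sub_nonneg.2 h16)
  nlinarith [hpos, k1, k2, k1', k2']

/-- The pointwise operator inequality `𝒜ψ ≤ −1` on the saddle disc for the quadratic `ψ` with
`s = π/(2L)`, `0 < ρ ≤ 1/(16(1 + 2s))`, `ν > 0`, written with the drift exactly as in the
registered statement (`a = 2πx/L`, `b = 2πy/L`). [folklore] -/
theorem saddle_operator_le {L ρ ν : ℝ} {ψ : ℝ → ℝ → ℝ}
    (hψ : ψ = fun x y => ((1 + Real.pi / (2 * L)) * ρ ^ 2 - (x - L / 2) ^ 2
      - 2 * (Real.pi / (2 * L)) * (x - L / 2) * y) / ν)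
    (hL : 0 < L) (hρ : 0 < ρ) (hρ1 : ρ ≤ 1 / (16 * (1 + 2 * (Real.pi / (2 * L))))) (hν : 0 < ν)
    {x y : ℝ} (hq : (x - L / 2) ^ 2 + y ^ 2 ≤ ρ ^ 2) :
    ν * lap ψ x y +
        Real.sinh (2 * Real.pi * y / L) /
            (2 * (Real.cosh (2 * Real.pi * y / L) - Real.cos (2 * Real.pi * x / L))) * dX ψ x y +
        (-(Real.sin (2 * Real.pi * x / L) /
            (2 * (Real.cosh (2 * Real.pi * y / L) - Real.cos (2 * Real.pi * x / L)))) - y) *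
          dY ψ x y ≤ -1 := by
  set s := Real.pi / (2 * L) with hs_def
  have hs : 0 < s := by positivity
  rw [lap_saddlePsi hψ, congrFun₂ (dX_saddlePsi hψ) x y, congrFun₂ (dY_saddlePsi hψ) x y]
  have hβ : 2 * Real.pi * y / L = 4 * s * y := by rw [hs_def]; field_simp; ring
  have hα : 2 * Real.pi * x / L = 4 * s * (x - L / 2) + Real.pi := by
    rw [hs_def]; field_simp; ring
  have hc₁ : Real.sinh (2 * Real.pi * y / L) /
        (2 * (Real.cosh (2 * Real.pi * y / L) - Real.cos (2 * Real.pi * x / L)))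
      = Real.sinh (4 * s * y) / (2 * (Real.cosh (4 * s * y) + Real.cos (4 * s * (x - L / 2)))) := by
    rw [hβ, hα, Real.cos_add_pi, sub_neg_eq_add]
  have hc₂ : -(Real.sin (2 * Real.pi * x / L) /
        (2 * (Real.cosh (2 * Real.pi * y / L) - Real.cos (2 * Real.pi * x / L)))) - y
      = Real.sin (4 * s * (x - L / 2)) /
          (2 * (Real.cosh (4 * s * y) + Real.cos (4 * s * (x - L / 2)))) - y := by
    rw [hβ, hα, Real.cos_add_pi, Real.sin_add_pi, sub_neg_eq_add, neg_div, neg_neg]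
  rw [hc₁, hc₂]
  have hP := saddle_transport_nonneg (X := x - L / 2) (Y := y) hs hρ hρ1 hq
  generalize Real.sinh (4 * s * y) / (2 * (Real.cosh (4 * s * y) + Real.cos (4 * s * (x - L / 2))))
    = c₁ at hP ⊢
  generalize Real.sin (4 * s * (x - L / 2)) /
      (2 * (Real.cosh (4 * s * y) + Real.cos (4 * s * (x - L / 2)))) = c₂ at hP ⊢
  have hrw : ν * (-2 / ν) + c₁ * ((-2 * (x - L / 2) - 2 * s * y) / ν)
        + (c₂ - y) * (-(2 * s * (x - L / 2)) / ν)
      = -2 - (2 / ν) * (c₁ * (x - L / 2 + s * y) + (c₂ - y) * (s * (x - L / 2))) := by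
    field_simp
    ring
  rw [hrw]
  have : 0 ≤ (2 / ν) * (c₁ * (x - L / 2 + s * y) + (c₂ - y) * (s * (x - L / 2))) :=
    mul_nonneg (by positivity) hP
  linarith

end SaddleExit

open SaddleExit in
/-- **Saddle-disc exit supersolution** for the frozen stretched point-vortex row (stub
`stub_saddleExit` of the line `braid-closed-large-circulation-gluing`). For `0 < L ≤ 1` put
`s = π/(2L)`, `ρ₁ = 1/(16(1 + 2s))`; for `0 < ρ ≤ ρ₁` put `C = (1 + 2s)ρ²`; for `ν > 0` the
polynomial `ψ(x, y) = ((1 + s)ρ² − (x − L/2)² − 2s(x − L/2)y)/ν` is `C²`, and on the closed disc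
`(x − L/2)² + y² ≤ ρ²` about the saddle stagnation point `(L/2, 0)` it satisfies `ψ ≥ 0`,
`νΔψ + u₀∂ₓψ + (v₀ − y)∂_yψ ≤ −1` (`u₀ = sinh b/(2(cosh b − cos a))`,
`v₀ = −sin a/(2(cosh b − cos a))`, `a = 2πx/L`, `b = 2πy/L`) and `ψ ≤ C/ν`. The construction uses
the isotropising quadratic form `X² + 2sXY` of `s²M⁻¹`, `M = [[0, s], [s, −1]]` the drift
linearisation, see the module docstring. [folklore] -/
theorem stub_saddleExit :
    ∀ L : ℝ, 0 < L → L ≤ 1 → ∃ ρ₁ : ℝ, 0 < ρ₁ ∧ ∀ ρ : ℝ, 0 < ρ → ρ ≤ ρ₁ → ∃ C : ℝ, 0 < C ∧ ∀ ν : ℝ, 0 < ν →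
      ∃ ψ : ℝ → ℝ → ℝ, ContDiff ℝ 2 (fun q : ℝ × ℝ => ψ q.1 q.2) ∧
        (∀ q ∈ {q : ℝ × ℝ | (q.1 - L / 2) ^ 2 + q.2 ^ 2 ≤ ρ ^ 2}, 0 ≤ ψ q.1 q.2) ∧
        (∀ q ∈ {q : ℝ × ℝ | (q.1 - L / 2) ^ 2 + q.2 ^ 2 ≤ ρ ^ 2},
          ν * lap ψ q.1 q.2 +
            Real.sinh (2 * Real.pi * q.2 / L) /
                (2 * (Real.cosh (2 * Real.pi * q.2 / L) - Real.cos (2 * Real.pi * q.1 / L))) * dX ψ q.1 q.2 +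
            (-(Real.sin (2 * Real.pi * q.1 / L) /
                (2 * (Real.cosh (2 * Real.pi * q.2 / L) - Real.cos (2 * Real.pi * q.1 / L)))) - q.2) * dY ψ q.1 q.2 ≤ -1) ∧
        (∀ q ∈ {q : ℝ × ℝ | (q.1 - L / 2) ^ 2 + q.2 ^ 2 ≤ ρ ^ 2}, ψ q.1 q.2 ≤ C / ν) := by
  intro L hL _hL1
  have hs : 0 < Real.pi / (2 * L) := by positivity
  refine ⟨1 / (16 * (1 + 2 * (Real.pi / (2 * L)))), by positivity, ?_⟩
  intro ρ hρ hρ1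
  refine ⟨(1 + 2 * (Real.pi / (2 * L))) * ρ ^ 2, by positivity, ?_⟩
  intro ν hν
  refine ⟨fun x y => ((1 + Real.pi / (2 * L)) * ρ ^ 2 - (x - L / 2) ^ 2
      - 2 * (Real.pi / (2 * L)) * (x - L / 2) * y) / ν, contDiff_saddlePsi rfl, ?_, ?_, ?_⟩
  · intro q hq
    exact saddlePsi_nonneg rfl hs.le hν hq
  · intro q hq
    exact saddle_operator_le rfl hL hρ hρ1 hν hq
  · intro q hq
    exact saddlePsi_le rfl hs.le hν hq

end Summit.AnomalousDissipation.AnomalousDissipation.Theorems.MarginalStabilityChainStretchedVortexRows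

end
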